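import Summits.QuantumFields.YangMills.Theorems.UnitScaleTiltProp7TransplantCutoffPotential
import HarnessLib

/-!
# Route `UnitScaleTilt`, crux K1 «MinimiserStabilityRegPr» (stmt-QuantumFields-19200), route-R E′ path (α′), (E1-b) at the CURVED background — near-field transplant, gen-1 cutoff letter:
# THE SYMMETRIC COMMUTATOR BOUND FOR A VECTOR-VALUED FIELD — `‖Δ₁(χ•F)(z) − χ(z)•Δ₁F(z)‖ ≤ d·(2a·Φ₁ + a₂·Φ₀)`, the matrix twin of px22 g3's ✓p678469 `abs_laplace_mul_sub_mul_laplace_le`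
# (his (G1-b) 23:36Z: the cutoff shells `c₁′ = [Δ, χ′]F₀`, `c₂′ = [Δ, χ′]Δ_flat F₀` of the second generation are vector-valued)

Cell `ym3-torus`, extra width seat `ym-routeR-w6` (gen 6).  THEOREMS ONLY (0 `def`, 0 `sorry`); `--supports stmt-QuantumFields-19200`, count-neutral.  YM₃ on T³ is a ladder rung (R3),
not the Clay problem; nothing here claims a stub, the crux, d = 4 or the mass gap.

WHAT IS PROVED (ns `…Theorems.Prop7TransplantCutoffCommutatorV`; `Site P j`, `V` a real normed space).
* `laplace_smul_sub_smul_laplace_eq` — the identity `Δ₁(χ•F)(z) − χ(z)•Δ₁F(z) = −Σ_ν[(χ(z+e_ν) − χ z)•(F(z+e_ν) − F(z−e_ν)) + (χ(z+e_ν) + χ(z−e_ν) − 2χ z)•F(z−e_ν)]`.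
* ★ `norm_laplace_smul_sub_smul_laplace_le` — the bound, hypotheses letter-for-letter those of ✓p678469 with `|·|` ↦ `‖·‖` on `F`.
* `laplace_smul_sub_smul_laplace_eq_flat` — the same commutator written against the numeral-free flat Laplacian of ✓p678447 (`Σ_μ((F z − F(T_μz)) + (F z − F(T_μ⁻¹z)))`), for the `hFsplit`
  binder of `covBilaplace_two_generation''` (`Δ_flat(χ′•F₀) = χ′•Δ_flat F₀ + c₁′`).

References: T. Bałaban, CMP 96 (1984) 223–250 [Balaban1984PropagatorsII] ((1.9) p.226); CMP 95 (1984) 17–40 [Balaban1984PropagatorsI] ((1.21) p.21).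
-/

set_option autoImplicit false

noncomputable section

open scoped BigOperators

namespace Summit.QuantumFields.YangMills.Theorems.Prop7TransplantCutoffCommutatorV

open Literature.MathematicalPhysics.QuantumFieldTheory.Balaban1983to89
open LatticeFieldCalculus (laplace)
open B9TorusCalculus (torusT torusT_apply torusT_symm_apply)

variable {P : Params} {j : ℕ} {V : Type*} [NormedAddCommGroup V] [NormedSpace ℝ V]

/-- the symmetric commutator identity, vector-valued. [cite: Balaban1984PropagatorsII, (1.9) p.226] -/
theorem laplace_smul_sub_smul_laplace_eq (χ : Site P j → ℝ) (F : Site P j → V) (z : Site P j) :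
    laplace 1 (fun w => χ w • F w) z - χ z • laplace 1 F z
      = ∑ ν : Fin P.d, -((χ (z.shift ν) - χ z) • (F (z.shift ν) - F (z.unshift ν))
          + (χ (z.shift ν) + χ (z.unshift ν) - 2 * χ z) • F (z.unshift ν)) := by
  simp only [laplace, one_pow, one_smul, Finset.smul_sum, ← Finset.sum_sub_distrib]
  refine Finset.sum_congr rfl fun ν _ => ?_
  simp only [smul_add, smul_sub, sub_smul, add_smul, mul_smul, two_smul]
  abel

/-- ★ **THE SYMMETRIC COMMUTATOR BOUND, VECTOR-VALUED**: `‖Δ₁(χ•F)(z) − χ(z)•Δ₁F(z)‖ ≤ d·(2a·Φ₁ + a₂·Φ₀)`. [cite: Balaban1984PropagatorsII, (1.9) p.226] -/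
theorem norm_laplace_smul_sub_smul_laplace_le (χ : Site P j → ℝ) (F : Site P j → V) (z : Site P j) {a a₂ Φ₀ Φ₁ : ℝ}
    (hχ1 : ∀ ν, |χ (z.shift ν) - χ z| ≤ a) (hχ2 : ∀ ν, |χ (z.shift ν) + χ (z.unshift ν) - 2 * χ z| ≤ a₂)
    (hF1 : ∀ ν, ‖F (z.shift ν) - F z‖ ≤ Φ₁ ∧ ‖F (z.unshift ν) - F z‖ ≤ Φ₁) (hF0 : ∀ ν, ‖F (z.unshift ν)‖ ≤ Φ₀) :
    ‖laplace 1 (fun w => χ w • F w) z - χ z • laplace 1 F z‖ ≤ P.d * (2 * a * Φ₁ + a₂ * Φ₀) := by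
  rw [laplace_smul_sub_smul_laplace_eq]
  refine (norm_sum_le _ _).trans ?_
  have hν : ∀ ν : Fin P.d, ‖-((χ (z.shift ν) - χ z) • (F (z.shift ν) - F (z.unshift ν))
      + (χ (z.shift ν) + χ (z.unshift ν) - 2 * χ z) • F (z.unshift ν))‖ ≤ 2 * a * Φ₁ + a₂ * Φ₀ := by
    intro ν
    have ha : 0 ≤ a := (abs_nonneg _).trans (hχ1 ν)
    have hd : ‖F (z.shift ν) - F (z.unshift ν)‖ ≤ 2 * Φ₁ := by
      have e : F (z.shift ν) - F (z.unshift ν) = (F (z.shift ν) - F z) - (F (z.unshift ν) - F z) := by abel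
      rw [e]
      calc _ ≤ ‖F (z.shift ν) - F z‖ + ‖F (z.unshift ν) - F z‖ := norm_sub_le _ _
        _ ≤ Φ₁ + Φ₁ := add_le_add (hF1 ν).1 (hF1 ν).2
        _ = 2 * Φ₁ := by ring
    calc _ ≤ ‖(χ (z.shift ν) - χ z) • (F (z.shift ν) - F (z.unshift ν))‖ + ‖(χ (z.shift ν) + χ (z.unshift ν) - 2 * χ z) • F (z.unshift ν)‖ := by
          rw [norm_neg]; exact norm_add_le _ _
      _ = |χ (z.shift ν) - χ z| * ‖F (z.shift ν) - F (z.unshift ν)‖ + |χ (z.shift ν) + χ (z.unshift ν) - 2 * χ z| * ‖F (z.unshift ν)‖ := by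
          rw [norm_smul, norm_smul, Real.norm_eq_abs, Real.norm_eq_abs]
      _ ≤ a * (2 * Φ₁) + a₂ * Φ₀ :=
          add_le_add (mul_le_mul (hχ1 ν) hd (norm_nonneg _) ha) (mul_le_mul (hχ2 ν) (hF0 ν) (norm_nonneg _) ((abs_nonneg _).trans (hχ2 ν)))
      _ = 2 * a * Φ₁ + a₂ * Φ₀ := by ring
  calc _ ≤ ∑ _ν : Fin P.d, (2 * a * Φ₁ + a₂ * Φ₀) := Finset.sum_le_sum fun ν _ => hν ν
    _ = P.d * (2 * a * Φ₁ + a₂ * Φ₀) := by rw [Finset.sum_const, Finset.card_univ, Fintype.card_fin, nsmul_eq_mul]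

/-- the commutator against the numeral-free flat Laplacian of ✓p678447 (`hFsplit`: `Δ_flat(χ•F) z = χ z • Δ_flat F z + c₁′ z` with `c₁′ z :=` the commutator). [cite: Balaban1984PropagatorsI, (1.21) p.21] -/
theorem laplace_smul_sub_smul_laplace_eq_flat (χ : Site P j → ℝ) (F : Site P j → V) (z : Site P j) :
    (∑ μ : Fin P.d, (((fun w => χ w • F w) z - (fun w => χ w • F w) (torusT P j μ z)) + ((fun w => χ w • F w) z - (fun w => χ w • F w) ((torusT P j μ).symm z))))
      = χ z • (∑ μ : Fin P.d, ((F z - F (torusT P j μ z)) + (F z - F ((torusT P j μ).symm z))))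
        + (laplace 1 (fun w => χ w • F w) z - χ z • laplace 1 F z) := by
  have h1 : ∀ (G : Site P j → V), laplace 1 G z = ∑ μ : Fin P.d, ((G z - G (torusT P j μ z)) + (G z - G ((torusT P j μ).symm z))) := by
    intro G
    simp only [laplace, one_pow, one_smul, torusT_apply, torusT_symm_apply]
    exact Finset.sum_congr rfl fun μ _ => by abel
  rw [h1, h1]
  abel

end Summit.QuantumFields.YangMills.Theorems.Prop7TransplantCutoffCommutatorV

end
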